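import Summits.NavierStokesRegularity.NavierStokesRegularity.Theses.TautLoopKelvin
import Summits.NavierStokesRegularity.NavierStokesRegularity.Theorems.Target.Negative.NormalForms
import Literature.Analysis.FluidPDE.ClassicalSolutionRescale
import Literature.Analysis.FluidPDE.LerayHopfNSRescale
import Literature.Analysis.FluidPDE.NSLerayHopfABCScaling
import Literature.Analysis.FluidPDE.NSViscosityRescaling
import Literature.Analysis.FluidPDE.SereginSverak2002PressureLowerBoundProofs

/-!
# `CirculationFloor` (stmt-NavierStokesRegularity-1538): normal form — WLOG `ν = 1` and `δ = 1`

Negative-side (cdisprove, D-0016) structure theorem for the crux `TautLoopKelvin.CirculationFloor`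
= `CirculationRelay.CirculationFloor` (shared entry ticket stmt-NavierStokesRegularity-1538), from the crux work
file `Cruxes/CirculationFloor/Disproof.lean` (cycle 1, 2026-08-17), in the style of
`Target/Negative/NormalForms.lean`:

* `circulationFloor_iff_unit` — NORMAL FORM. The crux (`∃ c₀ > 0 ∀ ν, T > 0 ∀ (u,p)` classical Leray–Hopf
  from a rapidly decaying datum with no smooth extension past `T`, `∀ δ > 0 ∃ t < T ∃` planar circle of radius
  `≤ δ` with `c₀ν ≤ |∮ u(t)·dl|`) is EQUIVALENT to its instance `ν = 1`, `δ = 1` (all lifespans `T`), with the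
  SAME constant `c₀`. Two exact symmetries of the hypothesis class transport every clause:
  the viscosity normalisation `v(s, x) = ν⁻¹ u(s/ν, x)` (Tao 2013, fn. 3: viscosity `ν ↦ 1`, lifespan `T ↦ νT`,
  circulations `Γ ↦ Γ/ν`; tree `IsClassicalNSSolutionOn.viscosityRescale_set`, `IsLerayHopfOn.viscosityRescale`,
  `hasRapidSpatialDecay_const_smul`, and `IsClassicalNSSolutionOn.stRescale` to carry a smooth extension back) and
  Leray's similarity `w(s, y) = δ v(δ²s, δy)` (lifespan `↦ νT/δ²`, a circle of radius `r'` for `w` is a circle of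
  radius `δr'` for `v` with the SAME circulation; tree `IsClassicalNSSolutionOn.nsRescale_holds`,
  `IsLerayHopfOn.nsRescale_holds`, `hasRapidSpatialDecay_nsRescaleData`). So the quantifiers `∀ ν` and `∀ δ` of
  the crux carry no content (they are free by scaling; `[Γ] = [ν]`), the level `c₀ν` with ABSOLUTE `c₀` is the
  only scaling-consistent shape, and a prover may assume `ν = 1` and control circles of radius `≤ 1` only
  (Littlewood–Paley scales `j ≥ 0`); a counterexample hunter has one dimensionless unknown, `c₀`.
* `circleIntegral_const_smul`, `circleIntegral_nsRescaleData` — the route's circle integral under `u ↦ a • u`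
  (factor `a`) and under the dilation of data `x ↦ l • u(l • x)` (centre `l • c`, radius `l r`, same value).

Nothing here closes the item (`--supports`). [cite: Leray1934, §20 (similarity transformation); Tao2013, fn. 3]
-/

noncomputable section

set_option linter.dupNamespace false

namespace Summit.NavierStokesRegularity.NavierStokesRegularity.Theorems.CirculationFloor.Negative

open Set Filter Topology MeasureTheory Function
open scoped InnerProductSpace RealInnerProductSpace
open Literature.Analysis.FluidPDE
open Summit.NavierStokesRegularity.NavierStokesRegularity.Theses
open Summit.NavierStokesRegularity.NavierStokesRegularity.Theorems.Target.Negative (hasRapidSpatialDecay_nsRescaleData)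

/-! ## The circle integral under the two scalings -/

/-- The route's circle integral of a constant multiple: `∮ (a u)·dl = a ∮ u·dl`. [folklore] -/
theorem circleIntegral_const_smul (a : ℝ) (v : EuclideanSpace ℝ (Fin 3) → EuclideanSpace ℝ (Fin 3))
    (c e₁ e₂ : EuclideanSpace ℝ (Fin 3)) (r : ℝ) :
    ∫ θ in (0 : ℝ)..(2 * Real.pi), inner ℝ ((a • v) (c + (r * Real.cos θ) • e₁ + (r * Real.sin θ) • e₂))
        ((-(r * Real.sin θ)) • e₁ + (r * Real.cos θ) • e₂) =
      a * ∫ θ in (0 : ℝ)..(2 * Real.pi), inner ℝ (v (c + (r * Real.cos θ) • e₁ + (r * Real.sin θ) • e₂))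
        ((-(r * Real.sin θ)) • e₁ + (r * Real.cos θ) • e₂) := by
  rw [← intervalIntegral.integral_const_mul]
  refine intervalIntegral.integral_congr (fun θ _ => ?_)
  simp only [Pi.smul_apply, real_inner_smul_left]

/-- The route's circle integral under the Navier–Stokes dilation of data `x ↦ l u(l x)`: the circle
(centre `c`, radius `r`) is carried to the circle (centre `l c`, radius `l r`) with the SAME value
(`⟪l U, τ⟫ = ⟪U, l τ⟫`; circulation is dimensionless under Leray's similarity). [folklore] -/
theorem circleIntegral_nsRescaleData (l : ℝ) (v : EuclideanSpace ℝ (Fin 3) → EuclideanSpace ℝ (Fin 3))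
    (c e₁ e₂ : EuclideanSpace ℝ (Fin 3)) (r : ℝ) :
    ∫ θ in (0 : ℝ)..(2 * Real.pi), inner ℝ (nsRescaleData l v (c + (r * Real.cos θ) • e₁ + (r * Real.sin θ) • e₂))
        ((-(r * Real.sin θ)) • e₁ + (r * Real.cos θ) • e₂) =
      ∫ θ in (0 : ℝ)..(2 * Real.pi), inner ℝ (v (l • c + ((l * r) * Real.cos θ) • e₁ + ((l * r) * Real.sin θ) • e₂))
        ((-((l * r) * Real.sin θ)) • e₁ + ((l * r) * Real.cos θ) • e₂) := by
  refine intervalIntegral.integral_congr (fun θ _ => ?_)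
  have h1 : l • (c + (r * Real.cos θ) • e₁ + (r * Real.sin θ) • e₂) =
      l • c + ((l * r) * Real.cos θ) • e₁ + ((l * r) * Real.sin θ) • e₂ := by
    module
  have h2 : l • ((-(r * Real.sin θ)) • e₁ + (r * Real.cos θ) • e₂) =
      (-((l * r) * Real.sin θ)) • e₁ + ((l * r) * Real.cos θ) • e₂ := by
    module
  simp only [nsRescaleData_apply]
  rw [real_inner_smul_left, ← real_inner_smul_right, h1, h2]

/-! ## Normal form: WLOG `ν = 1`, `δ = 1` -/

/-- **Normal form of `CirculationFloor`.** The crux is equivalent — with the same constant `c₀` — to its instance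
at viscosity `ν = 1` and radius bound `δ = 1` (all lifespans `T > 0`): `→` is specialisation; `←` transports a
general blow-up `(u, ν, T, δ)` by the viscosity normalisation `v = ν⁻¹u(ν⁻¹·, ·)` (to `ν = 1`, lifespan `νT`,
circulations divided by `ν`) and then by Leray's similarity `w = δ v(δ²·, δ·)` (lifespan `νT/δ²`; a circle of
radius `r' ≤ 1` for `w` is a circle of radius `δr' ≤ δ` for `v` with the same circulation); a smooth extension
of `w` or `v` would scale back to one of `u`. [folklore] -/
theorem circulationFloor_iff_unit :
    TautLoopKelvin.CirculationFloor ↔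
      ∃ c₀ : ℝ, 0 < c₀ ∧ ∀ T : ℝ, 0 < T →
        ∀ (u : ℝ → EuclideanSpace ℝ (Fin 3) → EuclideanSpace ℝ (Fin 3)) (p : ℝ → EuclideanSpace ℝ (Fin 3) → ℝ),
          IsClassicalNSSolutionOn (Set.Ico 0 T) 1 0 u p → IsLerayHopfOn T 1 0 (u 0) u →
          HasRapidSpatialDecay (u 0) → ¬ HasSmoothExtensionPast 1 0 u T →
          ∃ t ∈ Set.Ico 0 T, ∃ (c e₁ e₂ : EuclideanSpace ℝ (Fin 3)) (r : ℝ),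
            0 < r ∧ r ≤ 1 ∧ ‖e₁‖ = 1 ∧ ‖e₂‖ = 1 ∧ inner ℝ e₁ e₂ = 0 ∧
            c₀ ≤ |∫ θ in (0 : ℝ)..(2 * Real.pi), inner ℝ (u t (c + (r * Real.cos θ) • e₁ + (r * Real.sin θ) • e₂))
              ((-(r * Real.sin θ)) • e₁ + (r * Real.cos θ) • e₂)| := by
  constructor
  · rintro ⟨c₀, hc₀, h⟩
    refine ⟨c₀, hc₀, fun T hT u p hcl hLH hdec hext => ?_⟩
    obtain ⟨t, ht, c, e₁, e₂, r, hr, hr1, he₁, he₂, he12, hle⟩ :=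
      h 1 T one_pos hT u p hcl hLH hdec hext 1 one_pos
    exact ⟨t, ht, c, e₁, e₂, r, hr, hr1, he₁, he₂, he12, by rwa [mul_one] at hle⟩
  · rintro ⟨c₀, hc₀, h1⟩
    refine ⟨c₀, hc₀, fun ν T hν hT u p hcl hLH hdec hext δ hδ => ?_⟩
    /- Step 1: viscosity normalisation `v(s, x) = ν⁻¹ u(ν⁻¹ s, x)`, viscosity `1`, lifespan `νT`. -/
    have hν0 : ν ≠ 0 := hν.ne'
    have hνi : 0 < ν⁻¹ := inv_pos.2 hν
    have hνT : 0 < ν * T := mul_pos hν hT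
    set v : ℝ → EuclideanSpace ℝ (Fin 3) → EuclideanSpace ℝ (Fin 3) := timeRescale ν⁻¹ ν⁻¹ u with hv
    set π : ℝ → EuclideanSpace ℝ (Fin 3) → ℝ := timeRescale ν⁻¹ (ν⁻¹ ^ 2) p with hπ
    have hmaps : MapsTo (fun s => ν⁻¹ * s) (Ico 0 (ν * T)) (Ico 0 T) := by
      intro s hs
      refine ⟨mul_nonneg hνi.le hs.1, ?_⟩
      calc ν⁻¹ * s < ν⁻¹ * (ν * T) := mul_lt_mul_of_pos_left hs.2 hνi
        _ = T := by rw [← mul_assoc, inv_mul_cancel₀ hν0, one_mul]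
    have hclv : IsClassicalNSSolutionOn (Ico 0 (ν * T)) 1 0 v π := by
      have h := hcl.viscosityRescale_set hν0 hmaps (uniqueDiffOn_Ico 0 (ν * T))
      rwa [timeRescale_zero_force] at h
    have hv0 : ν⁻¹ • u 0 = v 0 := by
      funext x
      simp [hv]
    have hLHv : IsLerayHopfOn (ν * T) 1 0 (v 0) v := by
      have h := hLH.viscosityRescale hνi
      have e1 : T / ν⁻¹ = ν * T := by rw [div_inv_eq_mul, mul_comm]
      rwa [e1, inv_mul_cancel₀ hν0, timeRescale_zero_force, hv0] at h
    have hdecv : HasRapidSpatialDecay (v 0) := by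
      rw [← hv0]
      exact SereginSverak2002_pressureOneSidedBound.hasRapidSpatialDecay_const_smul
        (hcl.contDiff_velocity ⟨le_rfl, hT⟩) hdec ν⁻¹
    have hextv : ¬ HasSmoothExtensionPast 1 0 v (ν * T) := by
      rintro ⟨T₁', hT₁', v', π', hcl', hagree'⟩
      apply hext
      have key := hcl'.stRescale hν one_pos (by rw [mul_one]) 0 0
      have hset : ((fun r => (0 : ℝ) + ν * r) ⁻¹' Ico 0 T₁') = Ico 0 (T₁' / ν) := by
        ext r
        simp only [mem_preimage, zero_add, mem_Ico]
        rw [lt_div_iff₀ hν, mul_comm r ν]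
        constructor
        · rintro ⟨h0, h1'⟩
          exact ⟨by nlinarith [h0], h1'⟩
        · rintro ⟨h0, h1'⟩
          exact ⟨by positivity, h1'⟩
      rw [hset, smul_stPull_zero, show ν * (1 : ℝ) / 1 = ν by simp] at key
      refine ⟨T₁' / ν, by rw [gt_iff_lt, lt_div_iff₀ hν, mul_comm]; exact hT₁', _, _, key, fun t ht => ?_⟩
      funext x
      have hνt : ν * t ∈ Ico 0 (ν * T) := ⟨mul_nonneg hν.le ht.1, mul_lt_mul_of_pos_left ht.2 hν⟩
      show ν • v' (0 + ν * t) (0 + (1 : ℝ) • x) = u t x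
      rw [zero_add, zero_add, one_smul, hagree' (ν * t) hνt]
      show ν • (ν⁻¹ • u (ν⁻¹ * (ν * t)) x) = u t x
      rw [← mul_assoc, inv_mul_cancel₀ hν0, one_mul, smul_smul, mul_inv_cancel₀ hν0, one_smul]
    /- Step 2: Leray similarity `w(s, y) = δ v(δ² s, δ y)`, viscosity `1`, lifespan `νT/δ²`. -/
    have hδ2 : 0 < δ ^ 2 := by positivity
    have hTw : 0 < ν * T / δ ^ 2 := div_pos hνT hδ2
    set w : ℝ → EuclideanSpace ℝ (Fin 3) → EuclideanSpace ℝ (Fin 3) := nsRescale δ v with hw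
    set ϖ : ℝ → EuclideanSpace ℝ (Fin 3) → ℝ := nsRescalePressure δ π with hϖ
    have hset : ((fun t => δ ^ 2 * t) ⁻¹' Ico 0 (ν * T)) = Ico 0 (ν * T / δ ^ 2) := by
      ext t
      simp only [mem_preimage, mem_Ico]
      rw [lt_div_iff₀ hδ2, mul_comm t]
      constructor
      · rintro ⟨h0, h1'⟩
        exact ⟨by nlinarith [h0], h1'⟩
      · rintro ⟨h0, h1'⟩
        exact ⟨by positivity, h1'⟩
    have hclw : IsClassicalNSSolutionOn (Ico 0 (ν * T / δ ^ 2)) 1 0 w ϖ := by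
      have h := IsClassicalNSSolutionOn.nsRescale_holds hclv hδ
      rwa [hset, nsRescaleForce_zero] at h
    have hw0 : nsRescaleData δ (v 0) = w 0 := by
      funext x
      simp [hw, nsRescale_apply, nsRescaleData_apply]
    have hLHw : IsLerayHopfOn (ν * T / δ ^ 2) 1 0 (w 0) w := by
      have h := IsLerayHopfOn.nsRescale_holds hLHv hδ
      rwa [nsRescaleForce_zero, hw0] at h
    have hdecw : HasRapidSpatialDecay (w 0) := by
      rw [← hw0]
      exact hasRapidSpatialDecay_nsRescaleData (hclv.contDiff_velocity ⟨le_rfl, hνT⟩) hdecv hδ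
    have hextw : ¬ HasSmoothExtensionPast 1 0 w (ν * T / δ ^ 2) := by
      rintro ⟨T₂', hT₂', w', ϖ', hcl', hagree'⟩
      apply hextv
      have hci : 0 < δ⁻¹ := inv_pos.2 hδ
      have key := IsClassicalNSSolutionOn.nsRescale_holds hcl' hci
      have hset' : ((fun t => δ⁻¹ ^ 2 * t) ⁻¹' Ico 0 T₂') = Ico 0 (δ ^ 2 * T₂') := by
        ext t
        simp only [mem_preimage, mem_Ico, inv_pow]
        rw [← div_eq_inv_mul, le_div_iff₀ hδ2, div_lt_iff₀ hδ2, zero_mul, mul_comm T₂' (δ ^ 2)]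
      rw [hset', nsRescaleForce_zero] at key
      refine ⟨δ ^ 2 * T₂', ?_, _, _, key, fun t ht => ?_⟩
      · show ν * T < δ ^ 2 * T₂'
        rw [mul_comm (δ ^ 2) T₂']
        exact (div_lt_iff₀ hδ2).1 hT₂'
      · funext x
        have hts : δ⁻¹ ^ 2 * t ∈ Ico 0 (ν * T / δ ^ 2) := by
          rw [inv_pow, ← div_eq_inv_mul]
          exact ⟨div_nonneg ht.1 hδ2.le, div_lt_div_of_pos_right ht.2 hδ2⟩
        show δ⁻¹ • w' (δ⁻¹ ^ 2 * t) (δ⁻¹ • x) = v t x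
        rw [hagree' _ hts]
        show δ⁻¹ • (δ • v (δ ^ 2 * (δ⁻¹ ^ 2 * t)) (δ • δ⁻¹ • x)) = v t x
        rw [smul_smul, smul_smul, inv_mul_cancel₀ hδ.ne', one_smul, mul_inv_cancel₀ hδ.ne', one_smul,
          ← mul_assoc, ← mul_pow, mul_inv_cancel₀ hδ.ne', one_pow, one_mul]
    /- Step 3: the unit statement for `w`, transported back to `u`. -/
    obtain ⟨s, hs, c', e₁, e₂, r', hr', hr'1, he₁, he₂, he12, hΓ⟩ :=
      h1 (ν * T / δ ^ 2) hTw w ϖ hclw hLHw hdecw hextw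
    have hws : w s = nsRescaleData δ (v (δ ^ 2 * s)) := by
      funext y
      simp [hw, nsRescale_apply, nsRescaleData_apply]
    have hvs : v (δ ^ 2 * s) = ν⁻¹ • u (ν⁻¹ * (δ ^ 2 * s)) := by
      funext y
      simp [hv]
    rw [hws, circleIntegral_nsRescaleData, hvs, circleIntegral_const_smul, abs_mul, abs_of_pos hνi] at hΓ
    refine ⟨ν⁻¹ * (δ ^ 2 * s), ⟨mul_nonneg hνi.le (mul_nonneg hδ2.le hs.1), ?_⟩, δ • c', e₁, e₂, δ * r',
      mul_pos hδ hr', mul_le_of_le_one_right hδ.le hr'1, he₁, he₂, he12, ?_⟩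
    · rw [inv_mul_lt_iff₀ hν]
      calc δ ^ 2 * s < δ ^ 2 * (ν * T / δ ^ 2) := mul_lt_mul_of_pos_left hs.2 hδ2
        _ = ν * T := by field_simp
    · rw [le_inv_mul_iff₀ hν, mul_comm] at hΓ
      exact hΓ

end Summit.NavierStokesRegularity.NavierStokesRegularity.Theorems.CirculationFloor.Negative

end
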